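import Mathlib
import HarnessLib

/-!
# P3-PORT (K1): the K2 list-completeness CHECKER — a syndrome-driven DFS with sibling-forbidding over generator indices —
# and its STOP-PREFIX soundness theorem (cell `qec`, experiment CDX, seat qec-cdx-type-1; design = qec-cdx-idea-1 CARD-5)

Index level only (no circuit, no geometry): generators `0 … N−1` with syndrome bitmasks `syn n` (over checks `0 … C−1`) and
logical-parity bitmasks `lg n`; a WORD is a finite set of indices; its syndrome bit `c` is the parity of its members through `c`.
The checker `K2Data.cube` runs the depth-first search of CARD-5 §1 from a pivot with a live mask and a list `T` of allowed
stop masks; **`K2Data.dfs_sound`** (CARD-5 Theorem 1): if the run returns `true`, every zero-syndrome word `x ⊇ W` of size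
`≤ |W| + r` whose other members are live contains a STOP `S` (`W ⊆ S ⊆ x`, zero syndrome) that the run accepted
(`stopOK`: all logical parities even, or `|S| ≥ w − 1` and `mask S ∈ T`).  The translation to class-words is `PortK2Bridge`.
-/

namespace Summit.Ventures.QEC.CircuitDistance.K2

open Finset

/-- Checker data: number of generators/checks, syndrome and logical-parity masks per generator, candidate lists per
check (generators through the check, in the branching order), weight bound `w`, prune constant `M`. -/
structure K2Data where
  /-- number of generators -/
  N : ℕ
  /-- number of checks -/
  C : ℕ
  /-- syndrome bitmask of each generator -/
  syn : List ℕ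
  /-- logical-parity bitmask of each generator -/
  lg : List ℕ
  /-- generators through each check -/
  cand : List (List ℕ)
  /-- weight bound -/
  w : ℕ
  /-- max syndrome weight of a generator (prune) -/
  M : ℕ

/-- Syndrome mask of generator `n`. -/
def K2Data.synOf (D : K2Data) (n : ℕ) : ℕ := D.syn.getD n 0
/-- Logical-parity mask of generator `n`. -/
def K2Data.lgOf (D : K2Data) (n : ℕ) : ℕ := D.lg.getD n 0
/-- Candidates through check `c`. -/
def K2Data.candOf (D : K2Data) (c : ℕ) : List ℕ := D.cand.getD c []

/-- The first set bit below `C` (junk `0` if none). -/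
def firstBit (U C : ℕ) : ℕ := ((List.range C).find? fun c => U.testBit c).getD 0

/-- Number of set bits below `C`. -/
def popBelow (U C : ℕ) : ℕ := ((List.range C).filter fun c => U.testBit c).length

/-- A stop is accepted: all logical parities even, or weight `≥ w − 1` and an allowed mask. -/
def K2Data.stopOK (D : K2Data) (T : List ℕ) (L Wm card : ℕ) : Bool :=
  (L == 0) || (decide (D.w ≤ card + 1) && T.elem Wm)

/-- Iterate over the candidate list with progressive (sibling) forbidding. -/
def K2Data.goList (D : K2Data) (k : ℕ → ℕ → ℕ → ℕ → ℕ → Bool) (U L Wm card : ℕ) : List ℕ → ℕ → Bool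
  | [], _ => true
  | h :: hs, live =>
    if live.testBit h then
      k (U ^^^ D.synOf h) (L ^^^ D.lgOf h) (Wm ||| 2 ^ h) (card + 1) (live ^^^ 2 ^ h) &&
        D.goList k U L Wm card hs (live ^^^ 2 ^ h)
    else D.goList k U L Wm card hs live

/-- The DFS below a state `(U, L, Wm, card, live)` with fuel `r`: `false` iff an unaccepted stop is met. -/
def K2Data.dfs (D : K2Data) (T : List ℕ) : ℕ → ℕ → ℕ → ℕ → ℕ → ℕ → Bool
  | 0, U, L, Wm, card, _ => (U != 0) || D.stopOK T L Wm card
  | r + 1, U, L, Wm, card, live =>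
    if U = 0 then D.stopOK T L Wm card
    else if D.M * (r + 1) < popBelow U D.C then true
    else D.goList (D.dfs T r) U L Wm card (D.candOf (firstBit U D.C)) live

/-- One cube: pivot `p` with live mask `live` (not containing `p`), allowed stops `T`. -/
def K2Data.cube (D : K2Data) (T : List ℕ) (p live : ℕ) : Bool :=
  D.dfs T (D.w - 1) (D.synOf p) (D.lgOf p) (2 ^ p) 1 live

/-! ## Words, masks, syndrome parities -/

/-- Syndrome bit `c` of a word: parity of its members through `c`. -/
def K2Data.synBit (D : K2Data) (x : Finset ℕ) (c : ℕ) : Bool := decide (Odd (x.filter fun n => (D.synOf n).testBit c).card)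

/-- Logical-parity bit `j` of a word. -/
def K2Data.lgBit (D : K2Data) (x : Finset ℕ) (j : ℕ) : Bool := decide (Odd (x.filter fun n => (D.lgOf n).testBit j).card)

/-- A word has ZERO SYNDROME. -/
def K2Data.ZeroSyn (D : K2Data) (x : Finset ℕ) : Prop := ∀ c, D.synBit x c = false

/-- WELL-FORMED data: every syndrome mask is below `2^C`, has at most `M` bits, and every generator through a check is a
candidate of that check. -/
def K2Data.WF (D : K2Data) : Prop :=
  (∀ n < D.N, D.synOf n < 2 ^ D.C) ∧ (∀ n < D.N, popBelow (D.synOf n) D.C ≤ D.M) ∧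
    (∀ n < D.N, ∀ c < D.C, (D.synOf n).testBit c = true → n ∈ D.candOf c)


/-- `Wm` is a MASK of the finite set `S`: its bits are exactly the members. -/
def IsMask (Wm : ℕ) (S : Finset ℕ) : Prop := ∀ n, Wm.testBit n = decide (n ∈ S)

/-- Semantic stop condition: all logical parities even, or weight `≥ w − 1` and some allowed mask is a mask of `S`. -/
def K2Data.StopOK (D : K2Data) (T : List ℕ) (S : Finset ℕ) : Prop :=
  (∀ j, D.lgBit S j = false) ∨ (D.w ≤ S.card + 1 ∧ ∃ Wm ∈ T, IsMask Wm S)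

/-! ## Parity lemmas -/

/-- Syndrome bit of an insertion. -/
theorem K2Data.synBit_insert (D : K2Data) {W : Finset ℕ} {h : ℕ} (hh : h ∉ W) (c : ℕ) :
    D.synBit (insert h W) c = xor ((D.synOf h).testBit c) (D.synBit W c) := by
  unfold K2Data.synBit
  rw [Finset.filter_insert]
  by_cases hb : (D.synOf h).testBit c = true
  · rw [if_pos hb, Finset.card_insert_of_notMem (fun h' => hh (Finset.mem_filter.1 h').1), hb]
    simp only [Nat.odd_add_one, decide_not, Bool.true_xor]
  · rw [if_neg hb]; simp [hb]

/-- Logical bit of an insertion. -/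
theorem K2Data.lgBit_insert (D : K2Data) {W : Finset ℕ} {h : ℕ} (hh : h ∉ W) (j : ℕ) :
    D.lgBit (insert h W) j = xor ((D.lgOf h).testBit j) (D.lgBit W j) := by
  unfold K2Data.lgBit
  rw [Finset.filter_insert]
  by_cases hb : (D.lgOf h).testBit j = true
  · rw [if_pos hb, Finset.card_insert_of_notMem (fun h' => hh (Finset.mem_filter.1 h').1), hb]
    simp only [Nat.odd_add_one, decide_not, Bool.true_xor]
  · rw [if_neg hb]; simp [hb]

/-- Parity of a sum as `xor`. -/
theorem decide_odd_add (a b : ℕ) : decide (Odd (a + b)) = xor (decide (Odd a)) (decide (Odd b)) := by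
  by_cases ha : Odd a <;> by_cases hb : Odd b <;>
    simp [Nat.odd_add, ha, hb, Nat.not_odd_iff_even.symm]

/-- Syndrome bits split over a subset: `synBit x = synBit W ⊕ synBit (x \ W)`. -/
theorem K2Data.synBit_sdiff (D : K2Data) {W x : Finset ℕ} (hW : W ⊆ x) (c : ℕ) :
    D.synBit x c = xor (D.synBit W c) (D.synBit (x \ W) c) := by
  unfold K2Data.synBit
  have : x.filter (fun n => (D.synOf n).testBit c = true) =
      W.filter (fun n => (D.synOf n).testBit c = true) ∪ (x \ W).filter (fun n => (D.synOf n).testBit c = true) := by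
    rw [← Finset.filter_union, Finset.union_sdiff_of_subset hW]
  rw [this, Finset.card_union_of_disjoint (Finset.disjoint_filter_filter Finset.disjoint_sdiff), decide_odd_add]

/-- An odd syndrome bit has a witness. -/
theorem K2Data.exists_of_synBit (D : K2Data) {Y : Finset ℕ} {c : ℕ} (h : D.synBit Y c = true) :
    ∃ g ∈ Y, (D.synOf g).testBit c = true := by
  unfold K2Data.synBit at h
  rw [decide_eq_true_eq] at h
  obtain ⟨g, hg⟩ := Finset.card_pos.1 h.pos
  exact ⟨g, (Finset.mem_filter.1 hg).1, (Finset.mem_filter.1 hg).2⟩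

/-- Sub-additivity of the number of set syndrome bits of a word. -/
theorem K2Data.popBelow_word_le (D : K2Data) (Y : Finset ℕ) (U : ℕ) (hU : ∀ c, U.testBit c = D.synBit Y c) :
    popBelow U D.C ≤ ∑ g ∈ Y, popBelow (D.synOf g) D.C := by
  classical
  unfold popBelow
  have hsub : ((List.range D.C).filter fun c => U.testBit c).toFinset ⊆
      Y.biUnion fun g => ((List.range D.C).filter fun c => (D.synOf g).testBit c).toFinset := by
    intro c hc
    rw [List.mem_toFinset, List.mem_filter] at hc
    obtain ⟨hcC, hcU⟩ := hc
    rw [hU] at hcU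
    obtain ⟨g, hg, hgc⟩ := D.exists_of_synBit hcU
    rw [Finset.mem_biUnion]
    exact ⟨g, hg, by rw [List.mem_toFinset, List.mem_filter]; exact ⟨hcC, hgc⟩⟩
  have hnd : ∀ V : ℕ, ((List.range D.C).filter fun c => V.testBit c).Nodup := fun V => List.nodup_range.filter _
  calc ((List.range D.C).filter fun c => U.testBit c).length
      = ((List.range D.C).filter fun c => U.testBit c).toFinset.card := (List.toFinset_card_of_nodup (hnd U)).symm
    _ ≤ (Y.biUnion fun g => ((List.range D.C).filter fun c => (D.synOf g).testBit c).toFinset).card := Finset.card_le_card hsub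
    _ ≤ ∑ g ∈ Y, ((List.range D.C).filter fun c => (D.synOf g).testBit c).toFinset.card := Finset.card_biUnion_le
    _ = ∑ g ∈ Y, ((List.range D.C).filter fun c => (D.synOf g).testBit c).length :=
        Finset.sum_congr rfl fun g _ => List.toFinset_card_of_nodup (hnd _)

/-- `firstBit` finds a set bit of a non-zero number below `2^C`. -/
theorem firstBit_spec {U C : ℕ} (hne : U ≠ 0) (hlt : ∀ c, C ≤ c → U.testBit c = false) :
    firstBit U C < C ∧ U.testBit (firstBit U C) = true := by
  obtain ⟨i, hi, -⟩ := Nat.exists_most_significant_bit hne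
  have hiC : i < C := by by_contra h; rw [hlt i (not_lt.1 h)] at hi; exact Bool.false_ne_true hi
  unfold firstBit
  cases hf : (List.range C).find? (fun c => U.testBit c) with
  | none =>
    rw [List.find?_eq_none] at hf
    exact absurd hi (hf i (List.mem_range.2 hiC))
  | some c =>
    simp only [Option.getD_some]
    refine ⟨?_, List.find?_some hf⟩
    have := List.mem_of_find?_eq_some hf
    exact List.mem_range.1 this

/-! ## The candidate loop -/

/-- **Loop lemma.** If the loop over `l` succeeds and some member of `l` satisfies `Q` (all `Q`-members being live), then
for the FIRST such member `h` the child call succeeded with a live mask that still contains every other `Q`-element. -/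
theorem K2Data.goList_sound (D : K2Data) (k : ℕ → ℕ → ℕ → ℕ → ℕ → Bool) (U L Wm card : ℕ) (Q : ℕ → Prop) :
    ∀ (l : List ℕ) (live : ℕ), D.goList k U L Wm card l live = true → (∃ h ∈ l, Q h) →
      (∀ n, Q n → live.testBit n = true) →
      ∃ h ∈ l, Q h ∧ ∃ live' : ℕ, k (U ^^^ D.synOf h) (L ^^^ D.lgOf h) (Wm ||| 2 ^ h) (card + 1) live' = true ∧
        (∀ n, Q n → n ≠ h → live'.testBit n = true) ∧ live'.testBit h = false := by
  intro l
  induction l with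
  | nil => intro live _ hex; obtain ⟨h, hh, -⟩ := hex; simp at hh
  | cons a l ih =>
    intro live hgo hex hlive
    by_cases hQa : Q a
    · -- `a` is the first `Q`-element and it is live
      have ha : live.testBit a = true := hlive a hQa
      unfold K2Data.goList at hgo
      rw [if_pos ha, Bool.and_eq_true] at hgo
      refine ⟨a, List.mem_cons_self, hQa, live ^^^ 2 ^ a, hgo.1, fun n hn hne => ?_, ?_⟩
      · rw [Nat.testBit_xor, Nat.testBit_two_pow, hlive n hn]
        simp [Ne.symm hne]
      · rw [Nat.testBit_xor, Nat.testBit_two_pow, ha]; simp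
    · -- skip `a`
      have hex' : ∃ h ∈ l, Q h := by
        obtain ⟨h, hh, hQ⟩ := hex
        rcases List.mem_cons.1 hh with rfl | hh
        · exact absurd hQ hQa
        · exact ⟨h, hh, hQ⟩
      unfold K2Data.goList at hgo
      by_cases ha : live.testBit a = true
      · rw [if_pos ha, Bool.and_eq_true] at hgo
        have hlive' : ∀ n, Q n → (live ^^^ 2 ^ a).testBit n = true := by
          intro n hn
          have hne : a ≠ n := fun e => hQa (e ▸ hn)
          rw [Nat.testBit_xor, Nat.testBit_two_pow, hlive n hn]; simp [hne]
        obtain ⟨h, hh, hQ, live', hk, hrest, hself⟩ := ih _ hgo.2 hex' hlive'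
        exact ⟨h, List.mem_cons_of_mem _ hh, hQ, live', hk, hrest, hself⟩
      · rw [if_neg ha] at hgo
        obtain ⟨h, hh, hQ, live', hk, hrest, hself⟩ := ih _ hgo hex' hlive
        exact ⟨h, List.mem_cons_of_mem _ hh, hQ, live', hk, hrest, hself⟩

end Summit.Ventures.QEC.CircuitDistance.K2
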